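import Mathlib
import Summits.MatrixMultiplication.MatrixMultiplication.Theorems.SnSubsetDichotomyPolynomialSlackSpreadLevelOne

/-!
# Marginal bookkeeping and two Cauchy–Schwarz steps for the point-cylinder formula

Crux `Summit.MatrixMultiplication.MatrixMultiplication.Theses.SnSubsetDichotomy.PolynomialSlack`
(item `stmt-MatrixMultiplication-8306`), level-one programme, lead c3 — the elementary lemmas behind the
exact point-cylinder formula of `…PolynomialSlackCylinderPull` (crux notes §C): for `X ⊆ S_n` with marginal
counts `c_X(v,q) = #{x ∈ X : x q = v}` and pair marginals `m_{XY}(i,j) = #{(x,y) : y j = x i}`,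
* `sum_marginal_row` — `Σ_q c_X(v,q) = |X|` (columns: `sum_marginal_col` of `…SpreadLevelOne`);
* `pairMarginal_eq_sum_mul` — `m_{XY}(i,j) = Σ_v c_X(v,i)·c_Y(v,j)`, hence `mul_marginal_le_pairMarginal`;
* `abs_sum_kernel_le` — `|Σ_{p,w} a(p,w)x(w)y(p)| ≤ (R/2)(cΣx² + c⁻¹Σy²)` for a nonnegative kernel with row and
  column sums `R` (AM–GM termwise);
* `sum_sq_sum_mul_le` — `Σ_w (Σ_v ε(v)c(v,w))² ≤ (Σ_v ε(v)²·Σ_w c(v,w))·C` (Cauchy–Schwarz against a marginal);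
* `sum_ite_ne_mul` — summing against the flat-off-`i₀` weight.
-/

namespace Summit.MatrixMultiplication.MatrixMultiplication.Theorems.PolynomialSlack

open scoped BigOperators

set_option linter.dupNamespace false

variable {n : ℕ}

/-! ## Marginal bookkeeping -/

/-- Row sums of the marginal counts: `Σ_q #{x ∈ X : x q = v} = |X|` (each `x` takes the value `v` at
exactly one position, `x⁻¹ v`). [folklore] -/
theorem sum_marginal_row (X : Finset (Equiv.Perm (Fin n))) (v : Fin n) :
    ∑ q : Fin n, ((X.filter fun x => x q = v).card : ℝ) = X.card := by
  have h : ∀ q : Fin n, ((X.filter fun x => x q = v).card : ℝ) =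
      ∑ x ∈ X, if x q = v then (1 : ℝ) else 0 := fun q => by
    rw [Finset.card_filter]; push_cast; rfl
  simp_rw [h]
  rw [Finset.sum_comm]
  have h2 : ∀ x : Equiv.Perm (Fin n), ∑ q : Fin n, (if x q = v then (1 : ℝ) else 0) = 1 := by
    intro x
    have : ∀ q : Fin n, (x q = v) = (q = x.symm v) := fun q => by
      rw [Equiv.apply_eq_iff_eq_symm_apply]
    simp_rw [this]
    rw [Finset.sum_ite_eq' Finset.univ (x.symm v) (fun _ => (1 : ℝ))]
    simp
  simp_rw [h2]
  simp

/-- The pair marginal factors over the common value: `#{(x,y) : y j = x i} = Σ_v #{x : x i = v}·#{y : y j = v}`.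
[folklore] -/
theorem pairMarginal_eq_sum_mul (X Y : Finset (Equiv.Perm (Fin n))) (i j : Fin n) :
    (((X ×ˢ Y).filter fun xy => xy.2 j = xy.1 i).card : ℝ) =
      ∑ v : Fin n, ((X.filter fun x => x i = v).card : ℝ) * ((Y.filter fun y => y j = v).card : ℝ) := by
  have h := Finset.card_eq_sum_card_fiberwise
    (f := fun xy : Equiv.Perm (Fin n) × Equiv.Perm (Fin n) => xy.1 i)
    (s := (X ×ˢ Y).filter fun xy => xy.2 j = xy.1 i) (t := Finset.univ) (fun _ _ => Finset.mem_univ _)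
  rw [h]; push_cast
  refine Finset.sum_congr rfl fun v _ => ?_
  have hset : ((X ×ˢ Y).filter fun xy => xy.2 j = xy.1 i).filter
      (fun xy : Equiv.Perm (Fin n) × Equiv.Perm (Fin n) => xy.1 i = v) =
      (X.filter fun x => x i = v) ×ˢ (Y.filter fun y => y j = v) := by
    ext ⟨x, y⟩
    simp only [Finset.mem_filter, Finset.mem_product]
    constructor
    · rintro ⟨⟨⟨hx, hy⟩, h1⟩, h2⟩; exact ⟨⟨hx, h2⟩, hy, by rw [h1, h2]⟩
    · rintro ⟨⟨hx, h2⟩, hy, h1⟩; exact ⟨⟨⟨hx, hy⟩, by rw [h1, h2]⟩, h2⟩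
  rw [hset, Finset.card_product]; push_cast; rfl

/-- One term of the factorisation: `#{x : x i = v}·#{y : y j = v} ≤ #{(x,y) : y j = x i}`. [folklore] -/
theorem mul_marginal_le_pairMarginal (X Y : Finset (Equiv.Perm (Fin n))) (i j v : Fin n) :
    ((X.filter fun x => x i = v).card : ℝ) * ((Y.filter fun y => y j = v).card : ℝ) ≤
      (((X ×ˢ Y).filter fun xy => xy.2 j = xy.1 i).card : ℝ) := by
  rw [pairMarginal_eq_sum_mul]
  exact Finset.single_le_sum (f := fun v => ((X.filter fun x => x i = v).card : ℝ) *
    ((Y.filter fun y => y j = v).card : ℝ)) (fun _ _ => by positivity) (Finset.mem_univ v)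

/-! ## Two Cauchy–Schwarz steps -/

/-- Weighted AM–GM/Cauchy–Schwarz for a nonnegative kernel with constant row and column sums `R`:
`|Σ_{p,w} a(p,w)·x(w)·y(p)| ≤ (R/2)·(c·Σ x² + c⁻¹·Σ y²)` for every `c > 0`. [folklore] -/
theorem abs_sum_kernel_le (a : Fin n → Fin n → ℝ) (ha : ∀ p w, 0 ≤ a p w) (R : ℝ)
    (hrow : ∀ w, ∑ p : Fin n, a p w = R) (hcol : ∀ p, ∑ w : Fin n, a p w = R)
    (x y : Fin n → ℝ) (c : ℝ) (hc : 0 < c) :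
    |∑ p : Fin n, ∑ w : Fin n, a p w * x w * y p| ≤
      R / 2 * (c * ∑ w : Fin n, x w ^ 2 + c⁻¹ * ∑ p : Fin n, y p ^ 2) := by
  have hterm : ∀ p w, |a p w * x w * y p| ≤
      c / 2 * (a p w * x w ^ 2) + c⁻¹ / 2 * (a p w * y p ^ 2) := by
    intro p w
    have hxy : 2 * (|x w| * |y p|) ≤ c * x w ^ 2 + c⁻¹ * y p ^ 2 := by
      rw [← sub_nonneg]
      have e : c * x w ^ 2 + c⁻¹ * y p ^ 2 - 2 * (|x w| * |y p|) = (c * |x w| - |y p|) ^ 2 / c := by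
        rw [← sq_abs (x w), ← sq_abs (y p)]
        field_simp
        ring
      rw [e]; positivity
    rw [abs_mul, abs_mul, abs_of_nonneg (ha p w)]
    have h2 : a p w * |x w| * |y p| = a p w * (|x w| * |y p|) := by ring
    rw [h2]
    have h3 : c / 2 * (a p w * x w ^ 2) + c⁻¹ / 2 * (a p w * y p ^ 2) =
        a p w * ((c * x w ^ 2 + c⁻¹ * y p ^ 2) / 2) := by ring
    rw [h3]
    exact mul_le_mul_of_nonneg_left (by linarith) (ha p w)
  have hx : ∑ p : Fin n, ∑ w : Fin n, a p w * x w ^ 2 = R * ∑ w : Fin n, x w ^ 2 := by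
    rw [Finset.sum_comm, Finset.mul_sum]
    refine Finset.sum_congr rfl fun w _ => ?_
    rw [← Finset.sum_mul, hrow w]
  have hy : ∑ p : Fin n, ∑ w : Fin n, a p w * y p ^ 2 = R * ∑ p : Fin n, y p ^ 2 := by
    rw [Finset.mul_sum]
    refine Finset.sum_congr rfl fun p _ => ?_
    rw [← Finset.sum_mul, hcol p]
  calc |∑ p : Fin n, ∑ w : Fin n, a p w * x w * y p|
      ≤ ∑ p : Fin n, |∑ w : Fin n, a p w * x w * y p| := Finset.abs_sum_le_sum_abs _ _
    _ ≤ ∑ p : Fin n, ∑ w : Fin n, |a p w * x w * y p| :=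
        Finset.sum_le_sum fun p _ => Finset.abs_sum_le_sum_abs _ _
    _ ≤ ∑ p : Fin n, ∑ w : Fin n, (c / 2 * (a p w * x w ^ 2) + c⁻¹ / 2 * (a p w * y p ^ 2)) :=
        Finset.sum_le_sum fun p _ => Finset.sum_le_sum fun w _ => hterm p w
    _ = c / 2 * ∑ p : Fin n, ∑ w : Fin n, a p w * x w ^ 2 +
          c⁻¹ / 2 * ∑ p : Fin n, ∑ w : Fin n, a p w * y p ^ 2 := by
        simp_rw [Finset.sum_add_distrib, ← Finset.mul_sum]
    _ = R / 2 * (c * ∑ w : Fin n, x w ^ 2 + c⁻¹ * ∑ p : Fin n, y p ^ 2) := by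
        rw [hx, hy]; ring

/-- Cauchy–Schwarz against a marginal: `Σ_w (Σ_v ε(v)·c(v,w))² ≤ (Σ_v ε(v)²·Σ_w c(v,w))·C` when `c ≥ 0`
and every column sum `Σ_v c(v,w)` is `C`. [folklore] -/
theorem sum_sq_sum_mul_le (ε : Fin n → ℝ) (c : Fin n → Fin n → ℝ) (hc : ∀ v w, 0 ≤ c v w) (C : ℝ)
    (hcol : ∀ w, ∑ v : Fin n, c v w = C) :
    ∑ w : Fin n, (∑ v : Fin n, ε v * c v w) ^ 2 ≤
      (∑ v : Fin n, ε v ^ 2 * ∑ w : Fin n, c v w) * C := by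
  have hw : ∀ w, (∑ v : Fin n, ε v * c v w) ^ 2 ≤ (∑ v : Fin n, ε v ^ 2 * c v w) * C := by
    intro w
    have h := Finset.sum_mul_sq_le_sq_mul_sq Finset.univ
      (fun v => ε v * Real.sqrt (c v w)) (fun v => Real.sqrt (c v w))
    have e1 : ∀ v, ε v * Real.sqrt (c v w) * Real.sqrt (c v w) = ε v * c v w := fun v => by
      rw [mul_assoc, Real.mul_self_sqrt (hc v w)]
    have e2 : ∀ v, (ε v * Real.sqrt (c v w)) ^ 2 = ε v ^ 2 * c v w := fun v => by
      rw [mul_pow, Real.sq_sqrt (hc v w)]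
    have e3 : ∀ v, Real.sqrt (c v w) ^ 2 = c v w := fun v => Real.sq_sqrt (hc v w)
    simp_rw [e1, e2, e3, hcol w] at h
    exact h
  calc ∑ w : Fin n, (∑ v : Fin n, ε v * c v w) ^ 2
      ≤ ∑ w : Fin n, (∑ v : Fin n, ε v ^ 2 * c v w) * C := Finset.sum_le_sum fun w _ => hw w
    _ = (∑ v : Fin n, ε v ^ 2 * ∑ w : Fin n, c v w) * C := by
        rw [← Finset.sum_mul, Finset.sum_comm]
        congr 1
        refine Finset.sum_congr rfl fun v _ => ?_
        rw [Finset.mul_sum]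

/-! ## The flat-off-`i₀` weight -/

/-- A sum against the flat-off-`i₀` weight: `Σ_v [v ≠ i₀]·r·g(v) = r·(Σ_v g(v) - g(i₀))`. [folklore] -/
theorem sum_ite_ne_mul (i₀ : Fin n) (r : ℝ) (g : Fin n → ℝ) :
    ∑ v : Fin n, (if v = i₀ then (0 : ℝ) else r) * g v = r * (∑ v : Fin n, g v - g i₀) := by
  have h : ∀ v : Fin n, (if v = i₀ then (0 : ℝ) else r) * g v = r * g v - (if v = i₀ then r * g v else 0) := by
    intro v; split_ifs with hv <;> simp [hv]
  simp_rw [h]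
  rw [Finset.sum_sub_distrib, ← Finset.mul_sum, Finset.sum_ite_eq' Finset.univ i₀]
  simp [mul_sub]


end Summit.MatrixMultiplication.MatrixMultiplication.Theorems.PolynomialSlack
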